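/-
Copyright (c) 2026 the pub-hodgecm-mathlib formalisation cell (harness21).  Prover seat hodgecm-mathlib-K2E1-p10 (g0), Track B ∕ K2-LIT, h413 = `stmt-HodgeConjecture-24833`,
line `K2_E1_TraceFormulaBeta`, campaign «EIS-WHITTAKER-3», WAVE 2 «W3₃ FILE B» (dealer K2E1-plan (g5) RE-KEY 2026-09-04T09:14:07Z), brick B-split: THE SPLIT LOCAL WHITTAKER
FACTOR AS A PRODUCT-MEASURE INTEGRAL ON `Fin 3 → F` — the ψ-twisted twin of ★ (3-ii) `K2E1IntertwiningLocalMeanSplitU3`, in GK letters and in the base coordinates `(a, b, t)`.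
-/
import Summits.HodgeConjecture.HodgeConjecture.Theorems.K2E1LocalWhittakerPackageSplitU3     -- ★ C1₃-split (this seat): the window package; brings ★ D-W4 A–D (Haar form, unit value, holomorphy, bound, support)
import Summits.HodgeConjecture.HodgeConjecture.Theorems.K2E1BigCellCoordinateChangeGL3        -- ★ (K2E2-p12 g5): `measurePreserving_bigCellChange`, `integral_comp_bigCellChange_eq` on `Fin 3 → F`
import Mathlib.MeasureTheory.Integral.Pi
import HarnessLib

/-!
# K2·E1 — `K2E1WhittakerLocalMeanSplitU3` («W3₃ FILE B», brick B-split): THE SPLIT WHITTAKER LOCAL FACTOR ON `(Fin 3 → F, μ³)` —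
# `∫ max(1,‖x‖,‖z‖)^{−s}·max(1,‖y‖,‖z−xy‖)^{−s}·ψ₂(yξ₂)·ψ₁(xξ₁)` at `(x,y,z) = (a + δ₁b, −(a − δ₁b), δ₁t − ½(a+δ₁b)(a−δ₁b))` `dμ³(a,b,t)`: unit value `μ(𝒪)³(1−q^{−s})²(1−q^{−(2s−1)})`, window package

Track B ∕ K2-LIT, crux h413 = `stmt-HodgeConjecture-24833`, route of record `HCCMUnconditional`; cell `hodgecm-mathlib`, squad K2, ENGINE E1 (campaign «EIS-WHITTAKER-3», WAVE 2).
THEOREMS ONLY (no `def`, no `instance`, no notation, no named-fact hypothesis, no `sorry`; default heartbeats); lane `--supports stmt-HodgeConjecture-24833 --as helper` (count-neutral).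
Generic non-archimedean local field `F` (`= L⁺_v` at a place `v = ww̄` SPLIT in `L`), ANY additive Haar `μ`, currency `Measure.pi (fun _ : Fin 3 => μ)` on `Fin 3 → F` — the local factors of
★ `AdelicProductIntegral` at `ι = Fin 3` after ★ `K2E1FiniteAdeleBasisTransport` (W0₃ CONVENTIONS §1 (W), WIRING (β) db32e2773993304c §3) ARE product-measure integrals; `δ₁ = δ_w` with
`‖δ₁‖ = ‖2‖ = 1` off `S ⊇ S_δ ∪ {v ∣ 2}`; TWO continuous characters `ψ₁, ψ₂ : AddChar F Circle` (`= ψ_w, ψ_w̄` transported to `F = L_w = L_w̄`) with conductor exponents `m₁, m₂`,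
frequencies `ξ₁, ξ₂` (`= ξ_w, −ξ_w̄`: the chart's `y = −X_w̄`).  The ψ-TWISTED TWIN of ★ (3-ii) `K2E1IntertwiningLocalMeanSplitU3` (same equivalence `E q = (q₀,(q₂,q₁))`, same chart `Φ`).

THE MATHEMATICS [CasselmanShalika1980, Thm. 5.4; Casselman1980, Thm. 3.1; TateThesis1967, §3.3].  Everything analytic is ★ D-W4 (this seat, on `F × (F × F)` in coordinates `(x,(z,y))`):
★ `K2E1FiniteWhittakerSplitU3.integrable_twistedIntegrand` ∕ `integral_prod_bigCell_whittaker_gl3_eq` (unit value) ∕ `integral_prod_twisted_eq_iterated` (Haar = iterated), ★ C1₃-split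
`K2E1LocalWhittakerPackageSplitU3.exists_window_splitWhittakerPackage` (window package of the iterated form).  This brick MOVES them onto `(Fin 3 → F, μ³)`:
(§1) the twisted GK integrand in `Fin 3`-letters `G_W(q) := max(1,‖q₀‖,‖q₂‖)^{−s}·(max(1,‖q₁‖,‖q₂−q₀q₁‖)^{−s}·ψ₂(q₁ξ₂))·ψ₁(q₀ξ₁)` is `g_W ∘ E` for the measurable equivalence `E : (Fin 3 → F) ≃ᵐ F × (F × F)`,
`E q = (q₀,(q₂,q₁))`, carrying `μ³` to `μ ⊗ (μ ⊗ μ)` (packaged WITH its coordinate identities, reusable); hence **`Integrable G_W μ³`** (`1 < Re s`), **`∫ G_W dμ³ =` the iterated ★ D-W4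
integral** (`1 < Re s`, every frequency) and **`= μ(𝒪)³(1−q^{−s})²(1−q^{−(2s−1)})`** at frequencies of level zero; (§2) BASE COORDINATES by ★ `measurePreserving_bigCellChange` ∕
`integral_comp_bigCellChange_eq` (`Φ(a,b,t) = (a + δ₁b, −(a − δ₁b), δ₁t − ½(a+δ₁b)(a−δ₁b))`, `‖δ₁‖ = ‖2‖ = 1`): the same three statements for `G_W ∘ Φ`, whose height factor IS the split big-cell
height `∏_{w∣v} max(1,‖X_w‖,‖Z_w‖)` in the base coordinates (★ `K2E1IntertwiningLocalFactorU3HeightSplit`) and whose characters read `ψ₁((a+δ₁b)ξ₁)·ψ₂(−(a−δ₁b)ξ₂) = ψ_w(X_wξ_w)·ψ_w̄(X_w̄ξ_w̄)` at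
`ξ₂ = −ξ_w̄`; (§3) THE WINDOW PACKAGE IN `μ³`-CURRENCY: `∃ W^c` holomorphic on `{1 < Re s}` with `μ(𝒪)⁻³·∫ (G_W∘Φ) dμ³ = W^c(s)` on the window, unit value, `q`-uniform bound on
`Re s ≥ σ₁ > 1`, support (★ C1₃-split transported) — the per-place hypothesis of ★ C2₃-A `K2E1WhittakerFinitePartU3` at a split place, in the TOKEN currency of ★ `AdelicProductIntegral`.
SAT-WITNESS: nothing is quantified over a structure.
HONEST LABEL: HC_CM is proved only modulo the 7 printed citations (2 remaining named inputs: hLiu418 = `stmt-HodgeConjecture-24832`, h413 = `stmt-HodgeConjecture-24833`)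
until rung 0 closes; this file asserts no named fact and closes no socket; count-neutral.
References: [CasselmanShalika1980] Thm. 5.4 · [Casselman1980] §3, Thm. 3.1 · [TateThesis1967] Ch. XV §3.3 · [Langlands1971] §3.
-/

set_option autoImplicit false
-- the mandated namespace repeats the single-problem summit's segment (`HodgeConjecture.HodgeConjecture`)
set_option linter.dupNamespace false

noncomputable section

open MeasureTheory MeasureTheory.Measure Filter Topology Set TopologicalSpace
open scoped NNReal ENNReal
open Literature.NumberTheory.GaloisRepresentations Literature.NumberTheory.GaloisRepresentations.IsNonarchimedeanLocalField
open Literature.NumberTheory.Automorphic Literature.NumberTheory.Automorphic.LocalFieldHaar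
open Summit.HodgeConjecture.HodgeConjecture.Cruxes.H413.K2E1FiniteWhittakerSplitU3
open Summit.HodgeConjecture.HodgeConjecture.Cruxes.H413.K2E1FiniteWhittakerSplitU3Support
open Summit.HodgeConjecture.HodgeConjecture.Cruxes.H413.K2E1LocalWhittakerPackageSplitU3
open Summit.HodgeConjecture.HodgeConjecture.Cruxes.H413.K2E1BigCellCoordinateChangeGL3 (measurePreserving_bigCellChange integral_comp_bigCellChange_eq)

namespace Summit.HodgeConjecture.HodgeConjecture.Cruxes.H413.K2E1WhittakerLocalMeanSplitU3

variable {F : Type*} [Field F] [ValuativeRel F] [TopologicalSpace F] [IsNonarchimedeanLocalField F]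
variable [MeasurableSpace F] [BorelSpace F] (μ : Measure F) [μ.IsAddHaarMeasure]

/-! ## §1  The twisted Gindikin–Karpelevich integrand on `(Fin 3 → F, μ³)` -/

omit [BorelSpace F] in
/-- The coordinate equivalence `E : (Fin 3 → F) ≃ᵐ F × (F × F)`, `E q = (q₀, (q₂, q₁))`, carrying `μ³` to `μ ⊗ (μ ⊗ μ)` — packaged WITH its three coordinate identities (Mathlib
`piFinSuccAbove 0`, `finTwoArrow`, `prodComm`; the equivalence of ★ (3-ii) `exists_measurePreserving_gkCell`, exposed for every integrand). [cite: TateThesis1967, §3.3] -/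
theorem exists_measurePreserving_coords :
    ∃ E : (Fin 3 → F) ≃ᵐ F × (F × F), MeasurePreserving E (Measure.pi fun _ : Fin 3 => μ) (μ.prod (μ.prod μ)) ∧
      ∀ q : Fin 3 → F, (E q).1 = q 0 ∧ (E q).2.1 = q 2 ∧ (E q).2.2 = q 1 := by
  haveI := secondCountableTopology_localField F
  haveI := sigmaCompactSpace_of_isNonarchimedeanLocalField F
  set e₁ : (Fin 3 → F) ≃ᵐ F × (Fin 2 → F) := MeasurableEquiv.piFinSuccAbove (fun _ : Fin 3 => F) 0 with he₁
  have h₁ : MeasurePreserving e₁ (Measure.pi fun _ : Fin 3 => μ) (μ.prod (Measure.pi fun _ : Fin 2 => μ)) := measurePreserving_piFinSuccAbove (fun _ : Fin 3 => μ) 0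
  have h₂ : MeasurePreserving (MeasurableEquiv.finTwoArrow (α := F)) (Measure.pi fun _ : Fin 2 => μ) (μ.prod μ) := measurePreserving_finTwoArrow μ
  have h₃ : MeasurePreserving (MeasurableEquiv.prodComm (α := F) (β := F)) (μ.prod μ) (μ.prod μ) := measurePreserving_swap
  refine ⟨e₁.trans (MeasurableEquiv.prodCongr (MeasurableEquiv.refl F) ((MeasurableEquiv.finTwoArrow (α := F)).trans (MeasurableEquiv.prodComm (α := F) (β := F)))),
    ((MeasurePreserving.id μ).prod (h₃.comp h₂)).comp h₁, fun q => ⟨rfl, rfl, rfl⟩⟩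

/-- **`G_W` IS `μ³`-INTEGRABLE for `1 < Re s`** (every continuous `ψ₁ ψ₂`, every `ξ₁ ξ₂`; ★ `integrable_twistedIntegrand` transported along `E`). [cite: Casselman1980, Thm. 3.1] [cite: TateThesis1967, §3.3] -/
theorem integrable_whittakerCell_pi {ψ₁ ψ₂ : AddChar F Circle} (hψ₁ : Continuous ψ₁) (hψ₂ : Continuous ψ₂) (ξ₁ ξ₂ : F) {s : ℂ} (hs : 1 < s.re) :
    Integrable (fun q : Fin 3 → F => ((max 1 (max ((normAbs F (q 0) : ℝ≥0) : ℝ) ((normAbs F (q 2) : ℝ≥0) : ℝ)) : ℝ) : ℂ) ^ (-s) *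
      (((max 1 (max ((normAbs F (q 1) : ℝ≥0) : ℝ) ((normAbs F (q 2 - q 0 * q 1) : ℝ≥0) : ℝ)) : ℝ) : ℂ) ^ (-s) * ((ψ₂ (q 1 * ξ₂) : Circle) : ℂ)) *
        ((ψ₁ (q 0 * ξ₁) : Circle) : ℂ)) (Measure.pi fun _ : Fin 3 => μ) := by
  obtain ⟨E, hE, hEq⟩ := exists_measurePreserving_coords μ
  have h := (hE.integrable_comp_emb E.measurableEmbedding (g := fun p : F × (F × F) =>
    ((max 1 (max ((normAbs F p.1 : ℝ≥0) : ℝ) ((normAbs F p.2.1 : ℝ≥0) : ℝ)) : ℝ) : ℂ) ^ (-s) *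
      (((max 1 (max ((normAbs F p.2.2 : ℝ≥0) : ℝ) ((normAbs F (p.2.1 - p.1 * p.2.2) : ℝ≥0) : ℝ)) : ℝ) : ℂ) ^ (-s) * ((ψ₂ (p.2.2 * ξ₂) : Circle) : ℂ)) *
        ((ψ₁ (p.1 * ξ₁) : Circle) : ℂ))).mpr (integrable_twistedIntegrand μ hψ₁ hψ₂ ξ₁ ξ₂ hs)
  refine h.congr (Eventually.of_forall fun q => ?_)
  obtain ⟨h1, h2, h3⟩ := hEq q
  simp only [Function.comp_apply, h1, h2, h3]

/-- **`∫ G_W dμ³ =` THE ITERATED ★ D-W4 INTEGRAL** (`1 < Re s`, every frequency): `∫ G_W dμ³ = ∫_x (∫_z max(1,‖x‖,‖z‖)^{−s} ∫_y max(1,‖y‖,‖z−xy‖)^{−s}ψ₂(yξ₂)) ψ₁(xξ₁)` (transport along `E` + ★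
`integral_prod_twisted_eq_iterated`) — so every ★ D-W4 statement about the iterated form (holomorphy, bound, support, unit value) is a statement about the `μ³`-integral on the window.
[cite: Casselman1980, Thm. 3.1] [cite: TateThesis1967, §3.3] -/
theorem integral_whittakerCell_pi_eq_iterated {ψ₁ ψ₂ : AddChar F Circle} (hψ₁ : Continuous ψ₁) (hψ₂ : Continuous ψ₂) (ξ₁ ξ₂ : F) {s : ℂ} (hs : 1 < s.re) :
    ∫ q : Fin 3 → F, ((max 1 (max ((normAbs F (q 0) : ℝ≥0) : ℝ) ((normAbs F (q 2) : ℝ≥0) : ℝ)) : ℝ) : ℂ) ^ (-s) *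
        (((max 1 (max ((normAbs F (q 1) : ℝ≥0) : ℝ) ((normAbs F (q 2 - q 0 * q 1) : ℝ≥0) : ℝ)) : ℝ) : ℂ) ^ (-s) * ((ψ₂ (q 1 * ξ₂) : Circle) : ℂ)) *
          ((ψ₁ (q 0 * ξ₁) : Circle) : ℂ) ∂(Measure.pi fun _ : Fin 3 => μ) =
      ∫ x, (∫ z, ((max 1 (max ((normAbs F x : ℝ≥0) : ℝ) ((normAbs F z : ℝ≥0) : ℝ)) : ℝ) : ℂ) ^ (-s) *
        (∫ y, ((max 1 (max ((normAbs F y : ℝ≥0) : ℝ) ((normAbs F (z - x * y) : ℝ≥0) : ℝ)) : ℝ) : ℂ) ^ (-s) * ((ψ₂ (y * ξ₂) : Circle) : ℂ) ∂μ) ∂μ) *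
        ((ψ₁ (x * ξ₁) : Circle) : ℂ) ∂μ := by
  obtain ⟨E, hE, hEq⟩ := exists_measurePreserving_coords μ
  rw [← integral_prod_twisted_eq_iterated μ hψ₁ hψ₂ ξ₁ ξ₂ hs, ← hE.integral_comp']
  refine integral_congr_ae (Eventually.of_forall fun q => ?_)
  obtain ⟨h1, h2, h3⟩ := hEq q
  simp only [h1, h2, h3]

/-- **THE UNIT VALUE ON `(Fin 3 → F, μ³)`** (`ψᵢ` of conductor exponents `mᵢ`, `ξᵢ ∈ 𝔭^{mᵢ} ∖ 𝔭^{mᵢ+1}`, `1 < Re s`): `∫ G_W dμ³ = μ(𝒪)³·(1 − q^{−s})²·(1 − q^{−(2s−1)})`.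
[cite: CasselmanShalika1980, Thm. 5.4] [cite: Casselman1980, Thm. 3.1] -/
theorem integral_whittakerCell_pi_eq {ψ₁ ψ₂ : AddChar F Circle} (hψ₁ : Continuous ψ₁) (hψ₂ : Continuous ψ₂) {m₁ m₂ : ℤ}
    (hm₁ : ψ₁.HasConductorExp m₁) (hm₂ : ψ₂.HasConductorExp m₂) {ξ₁ ξ₂ : F}
    (hξ₁ : ξ₁ ∈ primePowBall F m₁) (hξ₁' : ξ₁ ∉ primePowBall F (m₁ + 1)) (hξ₂ : ξ₂ ∈ primePowBall F m₂) (hξ₂' : ξ₂ ∉ primePowBall F (m₂ + 1))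
    {s : ℂ} (hs : 1 < s.re) :
    ∫ q : Fin 3 → F, ((max 1 (max ((normAbs F (q 0) : ℝ≥0) : ℝ) ((normAbs F (q 2) : ℝ≥0) : ℝ)) : ℝ) : ℂ) ^ (-s) *
        (((max 1 (max ((normAbs F (q 1) : ℝ≥0) : ℝ) ((normAbs F (q 2 - q 0 * q 1) : ℝ≥0) : ℝ)) : ℝ) : ℂ) ^ (-s) * ((ψ₂ (q 1 * ξ₂) : Circle) : ℂ)) *
          ((ψ₁ (q 0 * ξ₁) : Circle) : ℂ) ∂(Measure.pi fun _ : Fin 3 => μ) =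
      (μ.real (primePowBall F 0) : ℂ) ^ 3 * ((1 - (residueFieldCard F : ℂ) ^ (-s)) ^ 2 * (1 - (residueFieldCard F : ℂ) ^ (-(2 * s - 1)))) := by
  rw [integral_whittakerCell_pi_eq_iterated μ hψ₁ hψ₂ ξ₁ ξ₂ hs, integral_bigCell_whittaker_gl3_eq μ hψ₁ hψ₂ hm₁ hm₂ hξ₁ hξ₁' hξ₂ hξ₂' hs]

/-! ## §2  Base coordinates `(a, b, t)`: the split local Whittaker factor `∫ G_W(Φ(a,b,t)) dμ³` -/

/-- **THE SPLIT LOCAL WHITTAKER INTEGRAND IS `μ³`-INTEGRABLE IN THE BASE COORDINATES** (`1 < Re s`, `‖δ₁‖ = ‖2‖ = 1`; ★ `measurePreserving_bigCellChange` + §1).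
[cite: Casselman1980, Thm. 3.1] [cite: TateThesis1967, §3.3] -/
theorem integrable_whittakerSplitCell_pi {δ₁ : F} (hδ : normAbs F δ₁ = 1) (h2 : normAbs F 2 = 1) {ψ₁ ψ₂ : AddChar F Circle} (hψ₁ : Continuous ψ₁) (hψ₂ : Continuous ψ₂)
    (ξ₁ ξ₂ : F) {s : ℂ} (hs : 1 < s.re) :
    Integrable (fun p : Fin 3 → F =>
      (fun q : Fin 3 → F => ((max 1 (max ((normAbs F (q 0) : ℝ≥0) : ℝ) ((normAbs F (q 2) : ℝ≥0) : ℝ)) : ℝ) : ℂ) ^ (-s) *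
        (((max 1 (max ((normAbs F (q 1) : ℝ≥0) : ℝ) ((normAbs F (q 2 - q 0 * q 1) : ℝ≥0) : ℝ)) : ℝ) : ℂ) ^ (-s) * ((ψ₂ (q 1 * ξ₂) : Circle) : ℂ)) *
          ((ψ₁ (q 0 * ξ₁) : Circle) : ℂ))
        ![p 0 + δ₁ * p 1, -(p 0 - δ₁ * p 1), δ₁ * p 2 - 2⁻¹ * (p 0 + δ₁ * p 1) * (p 0 - δ₁ * p 1)]) (Measure.pi fun _ : Fin 3 => μ) :=
  (measurePreserving_bigCellChange μ hδ h2).integrable_comp_of_integrable (integrable_whittakerCell_pi μ hψ₁ hψ₂ ξ₁ ξ₂ hs)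

/-- **THE SPLIT LOCAL WHITTAKER FACTOR EQUALS THE ITERATED ★ D-W4 INTEGRAL** (`1 < Re s`, `‖δ₁‖ = ‖2‖ = 1`, every frequency): `∫ G_W(Φ p) dμ³(p) = ∫_x (∫_z … ∫_y … ψ₂) ψ₁`
(★ `integral_comp_bigCellChange_eq` + §1). [cite: Casselman1980, Thm. 3.1] [cite: TateThesis1967, §3.3] -/
theorem integral_whittakerSplitCell_pi_eq_iterated {δ₁ : F} (hδ : normAbs F δ₁ = 1) (h2 : normAbs F 2 = 1) {ψ₁ ψ₂ : AddChar F Circle} (hψ₁ : Continuous ψ₁) (hψ₂ : Continuous ψ₂)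
    (ξ₁ ξ₂ : F) {s : ℂ} (hs : 1 < s.re) :
    ∫ p : Fin 3 → F, (fun q : Fin 3 → F => ((max 1 (max ((normAbs F (q 0) : ℝ≥0) : ℝ) ((normAbs F (q 2) : ℝ≥0) : ℝ)) : ℝ) : ℂ) ^ (-s) *
        (((max 1 (max ((normAbs F (q 1) : ℝ≥0) : ℝ) ((normAbs F (q 2 - q 0 * q 1) : ℝ≥0) : ℝ)) : ℝ) : ℂ) ^ (-s) * ((ψ₂ (q 1 * ξ₂) : Circle) : ℂ)) *
          ((ψ₁ (q 0 * ξ₁) : Circle) : ℂ))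
        ![p 0 + δ₁ * p 1, -(p 0 - δ₁ * p 1), δ₁ * p 2 - 2⁻¹ * (p 0 + δ₁ * p 1) * (p 0 - δ₁ * p 1)] ∂(Measure.pi fun _ : Fin 3 => μ) =
      ∫ x, (∫ z, ((max 1 (max ((normAbs F x : ℝ≥0) : ℝ) ((normAbs F z : ℝ≥0) : ℝ)) : ℝ) : ℂ) ^ (-s) *
        (∫ y, ((max 1 (max ((normAbs F y : ℝ≥0) : ℝ) ((normAbs F (z - x * y) : ℝ≥0) : ℝ)) : ℝ) : ℂ) ^ (-s) * ((ψ₂ (y * ξ₂) : Circle) : ℂ) ∂μ) ∂μ) *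
        ((ψ₁ (x * ξ₁) : Circle) : ℂ) ∂μ := by
  have h := integral_comp_bigCellChange_eq μ hδ h2
    (fun q : Fin 3 → F => ((max 1 (max ((normAbs F (q 0) : ℝ≥0) : ℝ) ((normAbs F (q 2) : ℝ≥0) : ℝ)) : ℝ) : ℂ) ^ (-s) *
        (((max 1 (max ((normAbs F (q 1) : ℝ≥0) : ℝ) ((normAbs F (q 2 - q 0 * q 1) : ℝ≥0) : ℝ)) : ℝ) : ℂ) ^ (-s) * ((ψ₂ (q 1 * ξ₂) : Circle) : ℂ)) *
          ((ψ₁ (q 0 * ξ₁) : Circle) : ℂ))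
  rw [h, integral_whittakerCell_pi_eq_iterated μ hψ₁ hψ₂ ξ₁ ξ₂ hs]

/-- **THE SPLIT LOCAL WHITTAKER FACTOR, UNIT VALUE, BASE COORDINATES** (`‖δ₁‖ = ‖2‖ = 1`, `ψᵢ` of conductor exponents `mᵢ`, `ξᵢ ∈ 𝔭^{mᵢ} ∖ 𝔭^{mᵢ+1}`, `1 < Re s`):
`∫ G_W(a + δ₁b, −(a − δ₁b), δ₁t − ½(a+δ₁b)(a−δ₁b)) dμ³(a,b,t) = μ(𝒪)³·(1 − q^{−s})²·(1 − q^{−(2s−1)})` — the `ε_v = +1` factor `[ζ_{L,w}(s)ζ_{L,w̄}(s)L_v(2s−1,ω)]⁻¹·μ(𝒪)³` of the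
Whittaker normaliser (W0₃ §4 (ii′)). [cite: CasselmanShalika1980, Thm. 5.4] [cite: Casselman1980, Thm. 3.1] -/
theorem integral_whittakerSplitCell_pi_eq {δ₁ : F} (hδ : normAbs F δ₁ = 1) (h2 : normAbs F 2 = 1) {ψ₁ ψ₂ : AddChar F Circle} (hψ₁ : Continuous ψ₁) (hψ₂ : Continuous ψ₂)
    {m₁ m₂ : ℤ} (hm₁ : ψ₁.HasConductorExp m₁) (hm₂ : ψ₂.HasConductorExp m₂) {ξ₁ ξ₂ : F}
    (hξ₁ : ξ₁ ∈ primePowBall F m₁) (hξ₁' : ξ₁ ∉ primePowBall F (m₁ + 1)) (hξ₂ : ξ₂ ∈ primePowBall F m₂) (hξ₂' : ξ₂ ∉ primePowBall F (m₂ + 1))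
    {s : ℂ} (hs : 1 < s.re) :
    ∫ p : Fin 3 → F, (fun q : Fin 3 → F => ((max 1 (max ((normAbs F (q 0) : ℝ≥0) : ℝ) ((normAbs F (q 2) : ℝ≥0) : ℝ)) : ℝ) : ℂ) ^ (-s) *
        (((max 1 (max ((normAbs F (q 1) : ℝ≥0) : ℝ) ((normAbs F (q 2 - q 0 * q 1) : ℝ≥0) : ℝ)) : ℝ) : ℂ) ^ (-s) * ((ψ₂ (q 1 * ξ₂) : Circle) : ℂ)) *
          ((ψ₁ (q 0 * ξ₁) : Circle) : ℂ))
        ![p 0 + δ₁ * p 1, -(p 0 - δ₁ * p 1), δ₁ * p 2 - 2⁻¹ * (p 0 + δ₁ * p 1) * (p 0 - δ₁ * p 1)] ∂(Measure.pi fun _ : Fin 3 => μ) =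
      (μ.real (primePowBall F 0) : ℂ) ^ 3 * ((1 - (residueFieldCard F : ℂ) ^ (-s)) ^ 2 * (1 - (residueFieldCard F : ℂ) ^ (-(2 * s - 1)))) := by
  have h := integral_comp_bigCellChange_eq μ hδ h2
    (fun q : Fin 3 → F => ((max 1 (max ((normAbs F (q 0) : ℝ≥0) : ℝ) ((normAbs F (q 2) : ℝ≥0) : ℝ)) : ℝ) : ℂ) ^ (-s) *
        (((max 1 (max ((normAbs F (q 1) : ℝ≥0) : ℝ) ((normAbs F (q 2 - q 0 * q 1) : ℝ≥0) : ℝ)) : ℝ) : ℂ) ^ (-s) * ((ψ₂ (q 1 * ξ₂) : Circle) : ℂ)) *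
          ((ψ₁ (q 0 * ξ₁) : Circle) : ℂ))
  rw [h, integral_whittakerCell_pi_eq μ hψ₁ hψ₂ hm₁ hm₂ hξ₁ hξ₁' hξ₂ hξ₂' hs]

omit [MeasurableSpace F] [BorelSpace F] in
/-- **THE EXPLICIT BASE-COORDINATE INTEGRAND** (★ bigCellChange's vector beta-reduced): the height letters of ★ (3-ii) `gkCell_bigCellChange_apply` times the characters
`ψ₂(−(p₀ − δ₁p₁)·ξ₂)·ψ₁((p₀ + δ₁p₁)·ξ₁)` — i.e. `ψ_w̄(X_w̄·ξ_w̄)·ψ_w(X_w·ξ_w)` at `X_w = a + δ_w b`, `X_w̄ = a − δ_w b`, `ξ₂ = −ξ_w̄`. [folklore] -/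
theorem whittakerCell_bigCellChange_apply (δ₁ : F) (ψ₁ ψ₂ : AddChar F Circle) (ξ₁ ξ₂ : F) (s : ℂ) (p : Fin 3 → F) :
    (fun q : Fin 3 → F => ((max 1 (max ((normAbs F (q 0) : ℝ≥0) : ℝ) ((normAbs F (q 2) : ℝ≥0) : ℝ)) : ℝ) : ℂ) ^ (-s) *
        (((max 1 (max ((normAbs F (q 1) : ℝ≥0) : ℝ) ((normAbs F (q 2 - q 0 * q 1) : ℝ≥0) : ℝ)) : ℝ) : ℂ) ^ (-s) * ((ψ₂ (q 1 * ξ₂) : Circle) : ℂ)) *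
          ((ψ₁ (q 0 * ξ₁) : Circle) : ℂ))
        ![p 0 + δ₁ * p 1, -(p 0 - δ₁ * p 1), δ₁ * p 2 - 2⁻¹ * (p 0 + δ₁ * p 1) * (p 0 - δ₁ * p 1)] =
      ((max 1 (max ((normAbs F (p 0 + δ₁ * p 1) : ℝ≥0) : ℝ) ((normAbs F (δ₁ * p 2 - 2⁻¹ * (p 0 + δ₁ * p 1) * (p 0 - δ₁ * p 1)) : ℝ≥0) : ℝ)) : ℝ) : ℂ) ^ (-s) *
        (((max 1 (max ((normAbs F (-(p 0 - δ₁ * p 1)) : ℝ≥0) : ℝ)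
          ((normAbs F (δ₁ * p 2 - 2⁻¹ * (p 0 + δ₁ * p 1) * (p 0 - δ₁ * p 1) - (p 0 + δ₁ * p 1) * (-(p 0 - δ₁ * p 1))) : ℝ≥0) : ℝ)) : ℝ) : ℂ) ^ (-s) *
          ((ψ₂ (-(p 0 - δ₁ * p 1) * ξ₂) : Circle) : ℂ)) * ((ψ₁ ((p 0 + δ₁ * p 1) * ξ₁) : Circle) : ℂ) := by
  simp only [Matrix.cons_val_zero, Matrix.cons_val_one, Matrix.cons_val_two, Matrix.head_cons, Matrix.tail_cons]

/-! ## §3  The window package in `μ³`-currency (the per-place hypothesis of ★ C2₃-A at a split place) -/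

/-- **THE SPLIT-PLACE PACKAGE IN THE TOKEN CURRENCY** (`‖δ₁‖ = ‖2‖ = 1`, `ψ₁, ψ₂` continuous of conductor exponents `m₁, m₂`, ANY `ξ₁, ξ₂`): there is `W^c : ℂ → ℂ` with (hol) `W^c`
holomorphic on `{1 < Re s}`; (i) `μ(𝒪)⁻³·∫ G_W(Φ p) dμ³ = W^c(s)` for `1 < Re s`; (unit) `ξᵢ ∈ 𝔭^{mᵢ} ∖ 𝔭^{mᵢ+1} ⟹ W^c(s) = (1 − q^{−s})²(1 − q^{−(2s−1)})` on the window; (bd′) for `σ₁ > 1`,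
`‖W^c(s)‖ ≤ (1−2^{1−σ₁})⁻²(1−2^{−(2σ₁−2)})⁻¹` on `Re s ≥ σ₁` (UNIFORM in `q, ξ, ψ`); (supp) `ξ₁ ∉ 𝔭^{m₁} ∨ ξ₂ ∉ 𝔭^{m₂} ⟹ W^c = 0` (★ C1₃-split `exists_window_splitWhittakerPackage` read
through §2). [cite: CasselmanShalika1980, Thm. 5.4] [cite: Casselman1980, Thm. 3.1] [cite: TateThesis1967, §3.3] -/
theorem exists_window_splitWhittakerPackage_pi {δ₁ : F} (hδ : normAbs F δ₁ = 1) (h2 : normAbs F 2 = 1) {ψ₁ ψ₂ : AddChar F Circle} (hψ₁ : Continuous ψ₁) (hψ₂ : Continuous ψ₂)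
    {m₁ m₂ : ℤ} (hm₁ : ψ₁.HasConductorExp m₁) (hm₂ : ψ₂.HasConductorExp m₂) (ξ₁ ξ₂ : F) :
    ∃ Wc : ℂ → ℂ, DifferentiableOn ℂ Wc {s : ℂ | 1 < s.re} ∧
      (∀ s : ℂ, 1 < s.re → ((μ.real (primePowBall F 0) : ℂ)⁻¹) ^ 3 *
        ∫ p : Fin 3 → F, (fun q : Fin 3 → F => ((max 1 (max ((normAbs F (q 0) : ℝ≥0) : ℝ) ((normAbs F (q 2) : ℝ≥0) : ℝ)) : ℝ) : ℂ) ^ (-s) *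
          (((max 1 (max ((normAbs F (q 1) : ℝ≥0) : ℝ) ((normAbs F (q 2 - q 0 * q 1) : ℝ≥0) : ℝ)) : ℝ) : ℂ) ^ (-s) * ((ψ₂ (q 1 * ξ₂) : Circle) : ℂ)) *
            ((ψ₁ (q 0 * ξ₁) : Circle) : ℂ))
          ![p 0 + δ₁ * p 1, -(p 0 - δ₁ * p 1), δ₁ * p 2 - 2⁻¹ * (p 0 + δ₁ * p 1) * (p 0 - δ₁ * p 1)] ∂(Measure.pi fun _ : Fin 3 => μ) = Wc s) ∧
      (ξ₁ ∈ primePowBall F m₁ → ξ₁ ∉ primePowBall F (m₁ + 1) → ξ₂ ∈ primePowBall F m₂ → ξ₂ ∉ primePowBall F (m₂ + 1) →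
        ∀ s : ℂ, 1 < s.re → Wc s = (1 - (residueFieldCard F : ℂ) ^ (-s)) ^ 2 * (1 - (residueFieldCard F : ℂ) ^ (-(2 * s - 1)))) ∧
      (∀ σ₁ : ℝ, 1 < σ₁ → ∀ s : ℂ, σ₁ ≤ s.re → ‖Wc s‖ ≤ ((1 - (2 : ℝ) ^ (1 - σ₁))⁻¹) ^ 2 * (1 - (2 : ℝ) ^ (-(2 * σ₁ - 2)))⁻¹) ∧
      (ξ₁ ∉ primePowBall F m₁ ∨ ξ₂ ∉ primePowBall F m₂ → Wc = 0) := by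
  obtain ⟨Wc, hhol, hi, hunit, -, hbd', hsupp⟩ := exists_window_splitWhittakerPackage μ hψ₁ hψ₂ hm₁ hm₂ ξ₁ ξ₂
  refine ⟨Wc, hhol, fun s hs => ?_, hunit, hbd', hsupp⟩
  rw [integral_whittakerSplitCell_pi_eq_iterated μ hδ h2 hψ₁ hψ₂ ξ₁ ξ₂ hs]
  exact hi s

end Summit.HodgeConjecture.HodgeConjecture.Cruxes.H413.K2E1WhittakerLocalMeanSplitU3

end
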